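import Mathlib
import HarnessLib
import Summits.ValiantsHypothesis.ValiantsHypothesis.Theses.ValuativeGCT
import Literature.Computability.Complexity.OccurrenceObstructionsIPProofs

/-!
# Sketch — first lemmas of three crux ideas for `ValuativeGCT.ValuativeFlip`
(stmt-ValiantsHypothesis-12624; crux-ideate round 1, ideator 1). Statements only (Props);
nothing here is an item. Each `def` is the `First lemma:` of one card in `Ideas/`.
-/

namespace Summit.ValiantsHypothesis.ValiantsHypothesis.Cruxes.ValuativeFlip.Sketch

open scoped BigOperators Matrix
open Literature.NumberTheory.DiophantineGeometry Literature.Computability.AlgebraicComplexity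
open Literature.Computability.Complexity

/-- Card `skew-restriction-rank`, first lemma (RESTRICTION-RANK BOUND, provable now):
for a singular space `U` (rank ≤ r < m on `U`) spanned by `u : Fin d → U`, the valuative truncation
`T_U(t)` with any threshold `t ≥ 1` lies in the kernel of the restriction map
`Res_u : G ↦ G(A(X))`, `A(X)` the generic element of `L_U` (row `j` of `A` is `∑_k X(j,k) u_k`),
hence `dim T_U(δ(m-r)) + rank (Res_u on T_U(0)) ≤ dim T_U(0)` (= the symmetric Kronecker count).
The line then bounds `rank Res_u|T_0` from BELOW by classical invariant theory of `Stab_H(U)`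
(for `U = Λ_m`: `SL_m`-invariants of skew tuples; blow-up determinants `det(∑ T_i ⊗ S_i)`). -/
def RestrictionRankBound : Prop :=
  ∀ (m : ℕ) [NeZero m] (U : Submodule ℂ (MatIdx m → ℂ)) (r δ : ℕ) (lam : Nat.Partition (m * δ))
    (d : ℕ) (u : Fin d → (MatIdx m → ℂ)),
    (∀ v ∈ U, (Matrix.of fun a b : Fin m => v (toLex (a, b))).rank ≤ r) →
    (∀ k, u k ∈ U) → Submodule.span ℂ (Set.range u) = U → 1 ≤ δ * (m - r) →
    let χ : Weight (MatIdx m) := (Weight.dualOfPartition (m * m) lam).toMatIdx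
    let T : ℕ → Submodule ℂ (MvPolynomial (MatIdx m × MatIdx m) ℂ) := fun t =>
      MvPolynomial.homogeneousSubmodule (MatIdx m × MatIdx m) ℂ (m * δ) ⊓
      ((MvPolynomial.vanishingIdeal ℂ
          {p : MatIdx m × MatIdx m → ℂ | ∀ j : MatIdx m, (fun i => p (j, i)) ∈ U}) ^ t).restrictScalars ℂ ⊓
      (⨅ (M : Matrix (MatIdx m) (MatIdx m) ℂ)
          (_ : linSubst (MatIdx m) ℂ M (detFormLex ℂ m) = detFormLex ℂ m),
          LinearMap.ker ((MvPolynomial.aeval (R := ℂ) fun p : MatIdx m × MatIdx m =>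
              ∑ l : MatIdx m, M l p.2 • MvPolynomial.X (p.1, l)).toLinearMap -
            LinearMap.id (R := ℂ) (M := MvPolynomial (MatIdx m × MatIdx m) ℂ))) ⊓
      (⨅ (g : Matrix.GeneralLinearGroup (MatIdx m) ℂ) (_ : IsUpperTriangular g),
          LinearMap.ker ((MvPolynomial.aeval (R := ℂ) fun p : MatIdx m × MatIdx m =>
              ∑ l : MatIdx m, ((g⁻¹ : Matrix.GeneralLinearGroup (MatIdx m) ℂ) :
                Matrix (MatIdx m) (MatIdx m) ℂ) p.1 l • MvPolynomial.X (l, p.2)).toLinearMap -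
            weightChar χ g • LinearMap.id (R := ℂ) (M := MvPolynomial (MatIdx m × MatIdx m) ℂ)))
    let Res : MvPolynomial (MatIdx m × MatIdx m) ℂ →ₐ[ℂ] MvPolynomial (MatIdx m × Fin d) ℂ :=
      MvPolynomial.aeval fun p : MatIdx m × MatIdx m => ∑ k : Fin d, u k p.2 • MvPolynomial.X (p.1, k)
    Module.finrank ℂ ↥(T (δ * (m - r))) + Module.finrank ℂ ↥((T 0).map Res.toLinearMap) ≤
      Module.finrank ℂ ↥(T 0)

/-- Card `per-anchor-catch-up`, first lemma (PER-SIDE ANCHOR = Kadish–Landsberg / BIP inheritance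
for multiplicities, known in print up to padding conventions): the multiplicity of `λ^*` in
`ℂ[Δ(per_n)]` (`m = n`, no padding) is at most the multiplicity of `(λ♯(n+j))^*` in the coordinate
ring of the orbit closure of the padded permanent `X₀₀^j per_n` of size `n + j`, for every `j`.
So the per side of the flip is ANCHORED at the padding-free function `P_n(λ) = mult_{λ^*} ℂ[Δ(per_n)]`. -/
def PerAnchorInheritance : Prop :=
  ∀ (n j δ : ℕ) [NeZero n] [NeZero (n + j)] (lam : Nat.Partition (n * δ)), lam.parts.card ≤ n * n →
    orbitMultiplicity ℂ (paddedPerFormLex ℂ n n) n (partitionWeightLex n lam) ≤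
      orbitMultiplicity ℂ (paddedPerFormLex ℂ n (n + j)) (n + j)
        (partitionWeightLex (n + j) (rowLift lam j))

/-- Card `per-anchor-catch-up`, the m-free anchor at the bottom of the window (free by a Hilbert-function
count, `dim Δ(per_n) = n⁴ - 2n + 2 > n⁴ - 2n² + 2 = dim End(W)//H`): for `n ≥ 3` some weight has larger
multiplicity for `per_n` than the symmetric Kronecker count, i.e. `ValuativeFlip`'s instance `m = n`
holds with `U = ⊥`, `r = 0` (threshold `δ n`, and `P_⊥ = 𝔪` so `T_⊥ = T_0`). Stated here with the
route's own decl by specialising the window to `m = n`. -/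
def BottomFlip : Prop :=
  ∀ (n : ℕ) [NeZero n], 3 ≤ n → ∃ (δ : ℕ) (lam : Nat.Partition (n * δ)), lam.parts.card ≤ n * n ∧
    orbitMultiplicity ℂ (detFormLex ℂ n) n (partitionWeightLex n lam) <
      orbitMultiplicity ℂ (paddedPerFormLex ℂ n n) n (partitionWeightLex n lam)

/-- Card `big-cell-semigroup-floor`, first lemma (MULTIPLICATIVITY OF HIGHEST-WEIGHT VECTORS in an
orbit-closure coordinate ring, which is a domain): products of nonzero highest-weight vectors of
weights `χ₁, χ₂` in `ℂ[Δ_m(f)]` are nonzero highest-weight vectors of weight `χ₁ + χ₂`. With a term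
order on the big-cell coordinates this upgrades to the leading-monomial semigroup and the sumset
floor `mult(χ₁+χ₂) ≥ mult(χ₁) + mult(χ₂) - 1` (Cauchy–Davenport in `ℤ^N`). -/
def HWVProduct : Prop :=
  ∀ {σ : Type} [Fintype σ] [LinearOrder σ] (f : MvPolynomial σ ℂ) (m : ℕ) (χ₁ χ₂ : Weight σ)
    (F G : OrbitCoordRing f m),
    F ∈ highestWeightSpace (orbitCoordRep f m) χ₁ → G ∈ highestWeightSpace (orbitCoordRep f m) χ₂ →
    F ≠ 0 → G ≠ 0 →
    F * G ∈ highestWeightSpace (orbitCoordRep f m) (χ₁ + χ₂) ∧ F * G ≠ 0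

/-- Card `big-cell-semigroup-floor`, the floor it yields (SUPERADDITIVITY MINUS ONE of orbit-closure
multiplicities along the weight semigroup; per side used at `f = per_n`). -/
def MultiplicitySumsetFloor : Prop :=
  ∀ {σ : Type} [Fintype σ] [LinearOrder σ] (f : MvPolynomial σ ℂ) (m : ℕ) (χ₁ χ₂ : Weight σ),
    0 < orbitMultiplicity ℂ f m χ₁ → 0 < orbitMultiplicity ℂ f m χ₂ →
    orbitMultiplicity ℂ f m χ₁ + orbitMultiplicity ℂ f m χ₂ ≤ orbitMultiplicity ℂ f m (χ₁ + χ₂) + 1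

/-- Card `skew-restriction-rank`, seed (LEVEL-TWO BLOW-UP DETERMINANTS SURVIVE ON SKEW TRIPLES, m = 3):
`det(∑_i T_i ⊗ S_i) ≠ 0` for some `2 × 2` blocks `T_i`, `S_i` the standard basis of `Λ_3`
(the regularising blow-up of the Edmonds-gap space `Λ_3`: `rk = 2 < ncrk = 3`). -/
def LevelTwoSkewWitness : Prop :=
  ∃ T : Fin 3 → Matrix (Fin 2) (Fin 2) ℚ,
    (∑ i : Fin 3, Matrix.kroneckerMap (· * ·) (T i)
      (fun a b : Fin 3 => if a = b then (0 : ℚ) else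
        if (i : ℕ) = 3 - (a : ℕ) - (b : ℕ) then (if a < b then 1 else -1) else 0)).det ≠ 0

end Summit.ValiantsHypothesis.ValiantsHypothesis.Cruxes.ValuativeFlip.Sketch
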